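import Mathlib
import Literature.Analysis.FluidPDE.HardSphereCollisionRecord
import Literature.Analysis.FluidPDE.HardSphereTorusMeasure
import Literature.Analysis.FluidPDE.HardSphereEuclideanTransfer
import Literature.MathematicalPhysics.KineticTheory.HardSphereEuler
import Literature.MathematicalPhysics.KineticTheory.HardSphereEulerProofs
import Summits.AtomisticToContinuum.HydrodynamicLimit.Theorems.OneFlightGossipEngineOneFlightLayeredChaosFirstFlightGhostInput
import HarnessLib

/-!
# `OneFlightGossipEngine.OneFlightLayeredChaos` — contact coordinates invert the entrance map on the torus
(crux stmt-AtomisticToContinuum-14535, line `Sketch`; a brick of the first-rung transfer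
`TwoDirectionGhostInput → FirstFlightGhostInput`, lead c4 wave 2; registered stub `freeEntranceTime_contact_eq`).

CONTACT COORDINATES for the tagged pair `(i, j)`, `j ≠ i`, on `𝕋³`: with relative velocity `g := v i − v j ≠ 0`, a
contact time `t > 0` with `‖g‖ t ≤ 1/4`, a unit INCOMING normal `ω` (`⟪ω, g⟫ ≤ 0`) and a diameter `0 < ε < 1/4`,
replace the position of `i` by `x' i := x j + proj (ε ω − t g)`.  Then

* (a) the entrance time (`freeEntranceTime`) of the two free flights of `i` and `j` issued from `zipConfig (x', v)`
  is EXACTLY `t`;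
* (b) at time `t` the minimal-image separation vector of the two free flights is exactly `ε ω` (so the contact
  normal `ε⁻¹ • sepVec` read at the entrance time is `ω`);
* (c) for every `s ≥ 0` with `‖g‖ s ≤ 1/4` the point `x j + proj (ε ω − s g)` is at minimal-image distance `≥ ε`
  from `x j` (the hard core of the pair is automatic in contact coordinates).

Geometry.  The relative position of the two free flights at time `u` is `proj (ε ω − (t − u) g)`
(`sepVec_freeFlight_contactUpdate`).  For `0 ≤ u ≤ t` one has `‖ε ω − (t − u) g‖ ≤ ε + t ‖g‖ < 1/2`, so no
wrap-around occurs and the minimal image is the Euclidean vector (`Torus.reprSym_proj_of_norm_lt`); and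
`‖ε ω − s g‖² = ε² − 2 ε s ⟪ω, g⟫ + s² ‖g‖² ≥ ε²`, strictly for `s > 0`.  Hence `t` is the least positive time at
which the two flights are within `ε`, and `freeEntranceTime_eq_of_isLeast` concludes.

References: C. Cercignani, R. Illner, M. Pulvirenti, *The Mathematical Theory of Dilute Gases* (1994), App. 4.A
(collision parametrisation `(t, ω) ↦ ε ω − t g`); I. Gallagher, L. Saint-Raymond, B. Texier, *From Newton to
Boltzmann* (2013), Ch. 4 intro (minimal image on `𝕋^d`).
-/

open Set
open scoped InnerProductSpace
open Literature.Analysis.FluidPDE Literature.Analysis.FunctionSpaces Literature.MathematicalPhysics.KineticTheory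

namespace Summit.AtomisticToContinuum.HydrodynamicLimit.Theorems.OLC

/-! ## Euclidean estimates for the contact parametrisation `ε ω − s g` -/

section Euclid

variable {E : Type*} [NormedAddCommGroup E] [InnerProductSpace ℝ E]

/-- `‖ε ω − s g‖² = ε² − 2 ε s ⟪ω, g⟫ + s² ‖g‖²` for a unit vector `ω`. [folklore] -/
theorem norm_smul_sub_smul_sq_of_norm_eq_one {ω : E} (hω : ‖ω‖ = 1) (ε s : ℝ) (g : E) :
    ‖ε • ω - s • g‖ ^ 2 = ε ^ 2 - 2 * (ε * s * ⟪ω, g⟫_ℝ) + s ^ 2 * ‖g‖ ^ 2 := by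
  rw [norm_sub_sq_real, real_inner_smul_left, real_inner_smul_right, norm_smul, norm_smul, hω, mul_one,
    Real.norm_eq_abs, Real.norm_eq_abs, sq_abs, mul_pow, sq_abs]
  ring

/-- **No recollapse on the incoming side.** For `ε ≥ 0`, `s ≥ 0`, a unit vector `ω` with `⟪ω, g⟫ ≤ 0`:
`ε ≤ ‖ε ω − s g‖`. [folklore] -/
theorem le_norm_smul_sub_smul_of_inner_nonpos {ε s : ℝ} (hε : 0 ≤ ε) (hs : 0 ≤ s) {ω g : E} (hω : ‖ω‖ = 1)
    (hin : ⟪ω, g⟫_ℝ ≤ 0) : ε ≤ ‖ε • ω - s • g‖ := by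
  refine le_of_pow_le_pow_left₀ two_ne_zero (norm_nonneg _) ?_
  rw [norm_smul_sub_smul_sq_of_norm_eq_one hω]
  have h1 : ε * s * ⟪ω, g⟫_ℝ ≤ 0 := mul_nonpos_of_nonneg_of_nonpos (mul_nonneg hε hs) hin
  have h2 : 0 ≤ s ^ 2 * ‖g‖ ^ 2 := by positivity
  linarith

/-- Strict version: for `ε ≥ 0`, `s > 0`, `g ≠ 0`, a unit vector `ω` with `⟪ω, g⟫ ≤ 0`: `ε < ‖ε ω − s g‖`.
[folklore] -/
theorem lt_norm_smul_sub_smul_of_inner_nonpos {ε s : ℝ} (hε : 0 ≤ ε) (hs : 0 < s) {ω g : E} (hω : ‖ω‖ = 1)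
    (hg : g ≠ 0) (hin : ⟪ω, g⟫_ℝ ≤ 0) : ε < ‖ε • ω - s • g‖ := by
  refine lt_of_pow_lt_pow_left₀ 2 (norm_nonneg _) ?_
  rw [norm_smul_sub_smul_sq_of_norm_eq_one hω]
  have h1 : ε * s * ⟪ω, g⟫_ℝ ≤ 0 := mul_nonpos_of_nonneg_of_nonpos (mul_nonneg hε hs.le) hin
  have h2 : 0 < s ^ 2 * ‖g‖ ^ 2 := mul_pos (pow_pos hs 2) (pow_pos (norm_pos_iff.2 hg) 2)
  linarith

/-- **No wrap-around in the window.** If `0 ≤ ε < 1/4`, `0 ≤ s`, `‖g‖ s ≤ 1/4` and `‖ω‖ = 1` then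
`‖ε ω − s g‖ < 1/2` (the contact parametrisation stays in the chart of the minimal image). [folklore] -/
theorem norm_smul_sub_smul_lt_half {ε s : ℝ} (hε : 0 ≤ ε) (hε4 : ε < 4⁻¹) (hs : 0 ≤ s) {ω g : E}
    (hω : ‖ω‖ = 1) (hgs : ‖g‖ * s ≤ 4⁻¹) : ‖ε • ω - s • g‖ < 1 / 2 := by
  calc ‖ε • ω - s • g‖ ≤ ‖ε • ω‖ + ‖s • g‖ := norm_sub_le _ _
    _ = ε + ‖g‖ * s := by
        rw [norm_smul, norm_smul, hω, mul_one, Real.norm_of_nonneg hε, Real.norm_of_nonneg hs, mul_comm]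
    _ < 4⁻¹ + 4⁻¹ := add_lt_add_of_lt_of_le hε4 hgs
    _ = 1 / 2 := by norm_num

end Euclid

/-! ## The separation of the two free flights in contact coordinates -/

section Torus

variable {n : ℕ}

/-- **Relative position in contact coordinates.** With `x i` replaced by `x j + proj (ε ω − t g)`, `g = v i − v j`,
the minimal-image separation vector of the free flights of `i` and `j ≠ i` at time `u` is
`reprSym (proj (ε ω − (t − u) g))`. [folklore] -/
theorem sepVec_freeFlight_contactUpdate (ε : ℝ) (x : Fin n → T3) (v : Fin n → V3) {i j : Fin n} (hij : j ≠ i)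
    (t : ℝ) (ω : V3) (u : ℝ) :
    (Torus.geometry (Fin 3)).sepVec
        (freeFlight (Torus.geometry (Fin 3)) u
          (zipConfig (Function.update x i (x j + Torus.proj (ε • ω - t • (v i - v j))), v)) i).1
        (freeFlight (Torus.geometry (Fin 3)) u
          (zipConfig (Function.update x i (x j + Torus.proj (ε • ω - t • (v i - v j))), v)) j).1 =
      Torus.reprSym (Torus.proj (ε • ω - (t - u) • (v i - v j))) := by
  simp only [freeFlight_apply, Torus.geometry_sepVec, Torus.geometry_translate, zipConfig_apply,
    Function.update_self, Function.update_of_ne hij]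
  have hsub : ∀ a b : V3, Torus.proj (a - b) = Torus.proj a - Torus.proj b := fun _ _ => rfl
  have h : x j + Torus.proj (ε • ω - t • (v i - v j)) + Torus.proj (u • v i) - (x j + Torus.proj (u • v j)) =
      Torus.proj (ε • ω - t • (v i - v j)) + Torus.proj (u • v i) - Torus.proj (u • v j) := by
    abel
  rw [h, ← Torus.proj_add, ← hsub]
  congr 1
  simp only [sub_smul, smul_sub]
  abel

end Torus

/-! ## The registered stub -/

/-- **Contact coordinates invert the entrance map on the torus (registered stub `freeEntranceTime_contact_eq`).**
For `0 < ε < 1/4`, positions `x`, velocities `v` with `g := v i − v j ≠ 0` (`j ≠ i`), a contact time `t > 0` with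
`‖g‖ t ≤ 1/4` and a unit incoming normal `ω` (`⟪ω, g⟫ ≤ 0`), put `x' := Function.update x i (x j + proj (ε ω − t g))`.
Then (a) the entrance time of the free flights of `i` and `j` issued from `zipConfig (x', v)` is exactly `t`;
(b) at time `t` their minimal-image separation vector is exactly `ε ω`; (c) for every `s ≥ 0` with `‖g‖ s ≤ 1/4`
the point `x j + proj (ε ω − s g)` is at minimal-image distance `≥ ε` from `x j`. [folklore] -/
theorem freeEntranceTime_contact_eq : ∀ {n : ℕ} {ε : ℝ}, 0 < ε → ε < 4⁻¹ → ∀ (x : Fin n → Literature.MathematicalPhysics.KineticTheory.T3) (v : Fin n → Literature.MathematicalPhysics.KineticTheory.V3) {i j : Fin n}, j ≠ i → v i ≠ v j → ∀ {t : ℝ}, 0 < t → ‖v i - v j‖ * t ≤ 4⁻¹ → ∀ {ω : Literature.MathematicalPhysics.KineticTheory.V3}, ‖ω‖ = 1 → inner ℝ ω (v i - v j) ≤ 0 → Summit.AtomisticToContinuum.HydrodynamicLimit.Theorems.OLC.freeEntranceTime ε (Literature.MathematicalPhysics.KineticTheory.zipConfig (Function.update x i (x j + Literature.Analysis.FunctionSpaces.Torus.proj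 (ε • ω - t • (v i - v j))), v)) i j = t ∧ (Literature.Analysis.FluidPDE.Torus.geometry (Fin 3)).sepVec (Literature.Analysis.FluidPDE.freeFlight (Literature.Analysis.FluidPDE.Torus.geometry (Fin 3)) t (Literature.MathematicalPhysics.KineticTheory.zipConfig (Function.update x i (x j + Literature.Analysis.FunctionSpaces.Torus.proj (ε • ω - t • (v i - v j))), v)) i).1 (Literature.Analysis.FluidPDE.freeFlight (Literature.Analysis.FluidPDE.Torus.geometry (Fin 3)) t (Literature.MathematicalPhysics.KineticTheory.zipConfig (Function.update x i (x j + Literature.Analysis.FunctionSpaces.Torus.proj (ε • ω - t • (v i - v j))), v)) j).1 = ε • ω ∧ ∀ s : ℝ, 0 ≤ s → ‖v i - v j‖ * s ≤ 4⁻¹ → ε ≤ Literature.Analysis.FluidPDE.Torus.euclidDist (x j + Literature.Analysis.FunctionSpaces.Torus.proj (ε • ω - s • (v i - v j))) (x j) := by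
  intro n ε hε hε4 x v i j hij hvij t ht hgt ω hω hin
  have hg : v i - v j ≠ 0 := sub_ne_zero.2 hvij
  -- no wrap-around: the contact parametrisation stays in the chart of the minimal image
  have hchart : ∀ s : ℝ, 0 ≤ s → ‖v i - v j‖ * s ≤ 4⁻¹ →
      Torus.reprSym (Torus.proj (ε • ω - s • (v i - v j))) = ε • ω - s • (v i - v j) := fun s hs hgs =>
    Torus.reprSym_proj_of_norm_lt (norm_smul_sub_smul_lt_half hε.le hε4 hs hω hgs)
  -- the separation of the two free flights at a time `u ∈ [0, t]` is the Euclidean vector `ε ω − (t − u) g`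
  have hsep : ∀ u : ℝ, 0 ≤ u → u ≤ t →
      (Torus.geometry (Fin 3)).sepVec
          (freeFlight (Torus.geometry (Fin 3)) u
            (zipConfig (Function.update x i (x j + Torus.proj (ε • ω - t • (v i - v j))), v)) i).1
          (freeFlight (Torus.geometry (Fin 3)) u
            (zipConfig (Function.update x i (x j + Torus.proj (ε • ω - t • (v i - v j))), v)) j).1 =
        ε • ω - (t - u) • (v i - v j) := by
    intro u hu0 hut
    rw [sepVec_freeFlight_contactUpdate ε x v hij t ω u]
    refine hchart (t - u) (sub_nonneg.2 hut) (le_trans ?_ hgt)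
    exact mul_le_mul_of_nonneg_left (by linarith) (norm_nonneg _)
  have hsept : (Torus.geometry (Fin 3)).sepVec
      (freeFlight (Torus.geometry (Fin 3)) t
        (zipConfig (Function.update x i (x j + Torus.proj (ε • ω - t • (v i - v j))), v)) i).1
      (freeFlight (Torus.geometry (Fin 3)) t
        (zipConfig (Function.update x i (x j + Torus.proj (ε • ω - t • (v i - v j))), v)) j).1 = ε • ω := by
    rw [hsep t ht.le le_rfl, sub_self, zero_smul, sub_zero]
  have hnormε : ‖ε • ω‖ = ε := by rw [norm_smul, Real.norm_of_nonneg hε.le, hω, mul_one]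
  refine ⟨freeEntranceTime_eq_of_isLeast ⟨⟨ht, ?_⟩, fun u hu => ?_⟩, hsept, fun s hs0 hgs => ?_⟩
  · -- `t` is in the set: the flights are at distance exactly `ε`
    rw [hsept, hnormε]
  · -- `t` is a lower bound: before `t` (and after `0`) the flights are at distance `> ε`
    obtain ⟨hu0, hule⟩ := hu
    by_contra hlt
    have hlt' : u < t := lt_of_not_ge hlt
    rw [hsep u hu0.le hlt'.le] at hule
    exact (not_lt.2 hule) (lt_norm_smul_sub_smul_of_inner_nonpos hε.le (sub_pos.2 hlt') hω hg hin)
  · -- hard core of the pair in contact coordinates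
    rw [Torus.euclidDist_eq, add_sub_cancel_left, hchart s hs0 hgs]
    exact le_norm_smul_sub_smul_of_inner_nonpos hε.le hs0 hω hin

end Summit.AtomisticToContinuum.HydrodynamicLimit.Theorems.OLC
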